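import Literature.MathematicalPhysics.KineticTheory.LangevinChainHormander
import Literature.Analysis.ODE.PicardForcing
import Mathlib.Analysis.Calculus.MeanValue
import HarnessLib

/-!
# The Langevin chain driven by a continuous noise path: pathwise (strong) solutions

Trunk T-KINETIC (Literature/MathematicalPhysics/KineticTheory). Cuneo–Eckmann–Hairer–Rey-Bellet,
EJP 23 (2018) no. 55, §2 eq. (2.2) and §3 p. 7: "the process admits strong solutions that are
continuous and defined for all `t ≥ 0` (almost surely)". For the chain `P : OscillatorChain` with
`N` sites the SDE (2.2) is `dz = Y(z) dt + ∑_b √(2γT_b) e_{p_b} dW_b` with the drift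
`Y = P.drift N` of `LangevinChainHormander.lean`; since the noise is ADDITIVE, for every continuous
momentum-noise path `η : ℝ → (Fin N → ℝ)` (in the application `η_i(t) = [i=0]√(2γT_L) W_L(t) +
[i=N-1]√(2γT_R) W_R(t)`) the equation is the integral equation

  `z(t) = x + (0, η(t)) + ∫₀ᵗ Y(z(s)) ds`                                                  (IE)

and is solved path by path (this file; no probability): the **deterministic layer of the
construction of the transition semigroup** of (2.2).

* `Literature.MathematicalPhysics.KineticTheory.radialCutoff`, `Literature.MathematicalPhysics.KineticTheory.truncateField` — a Lipschitz cutoff of a locally Lipschitz field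
  outside the ball of radius `2R`, equal to the field on the ball of radius `R`
  (`lipschitzWith_truncateField`).
* `OscillatorChain.fderiv_hamiltonian_apply`, `OscillatorChain.fderiv_hamiltonian_drift_le` — the
  energy identity `DH(y)·Y(y + (0,e)) = ∑_i ∂_{q_i}H e_i - γ ∑_b p_b² - γ ∑_b p_b e_b
  ≤ ‖e‖ (∑_i |∂_{q_i}H| + 2γ ∑_i |p_i|)` (dissipation dropped).
* `pinnedChain_linearEnergyBound` — for the pinned chain, `∑_i |∂_{q_i}H| + 2γ∑_i|p_i| ≤ C(1+H)`.
* `pinnedChain_hamiltonian_truncSol_le` — the **a-priori energy bound** for the solution `z` of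
  (IE) with the truncated drift: `1 + H(z(t) - (0,η(t))) ≤ (1 + H(x)) e^{C M t}`,
  `M = sup_{[0,T]} ‖η‖` (Grönwall for `t ↦ H(y(t))`, `y = z - (0, η)`, `y' = Y_R(z)`), whence a
  radius `pinnedChainRadius` with `‖z(t)‖ ≤ R₀(T, H(x), M)` on `[0, T]`, uniform in the truncation.
* `OscillatorChain.chainFlow P N x η t` — the solution of (IE): the (eventually constant) limit of
  the Picard solutions of the truncated equations; for the pinned chain (`ω₂ > 0`,
  `lam, β, γ ≥ 0`) it is continuous in `t`, solves (IE) on every `[0, T]`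
  (`pinnedChain_isIntegralSolutionOn_chainFlow`), is the unique continuous solution
  (`pinnedChain_eqOn_chainFlow`), depends on `η` only through `η|[0,T]`, satisfies the cocycle
  identity `z_{x,η}(s+t) = z_{z_{x,η}(s), η(s+·)-η(s)}(t)` (`pinnedChain_chainFlow_add`) and is
  continuous in the initial condition (`pinnedChain_continuous_chainFlow_left`).

## References

* N. Cuneo, J.-P. Eckmann, M. Hairer, L. Rey-Bellet, EJP 23 (2018) no. 55, §2 (2.2), §3 p. 7.
* R. Khasminskii, *Stochastic Stability of Differential Equations* (2nd ed., 2012), Thm 3.5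
  (non-explosion from a Lyapunov function), §3.4.
* E. A. Coddington, N. Levinson, *Theory of Ordinary Differential Equations* (1955), Ch. 1.
-/

noncomputable section

open MeasureTheory Filter Topology Set Metric
open scoped NNReal ContDiff

namespace Literature.MathematicalPhysics.KineticTheory

/-! ### A Lipschitz cutoff of a locally Lipschitz vector field -/

section Truncate

variable {E : Type*} [NormedAddCommGroup E]

/-- The radial cutoff `χ_R(z) = max(0, min(1, 2 - ‖z‖/R))`: `= 1` on the closed ball of radius
`R`, `= 0` outside the ball of radius `2R`, `1/R`-Lipschitz, values in `[0, 1]`. [folklore] -/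
def radialCutoff (R : ℝ) (z : E) : ℝ :=
  max 0 (min 1 (2 - ‖z‖ / R))

/-- `0 ≤ χ_R`. [folklore] -/
theorem radialCutoff_nonneg (R : ℝ) (z : E) : 0 ≤ radialCutoff R z :=
  le_max_left _ _

/-- `χ_R ≤ 1`. [folklore] -/
theorem radialCutoff_le_one (R : ℝ) (z : E) : radialCutoff R z ≤ 1 :=
  max_le zero_le_one (min_le_left _ _)

/-- `|χ_R| ≤ 1`. [folklore] -/
theorem abs_radialCutoff_le_one (R : ℝ) (z : E) : |radialCutoff R z| ≤ 1 := by
  rw [abs_of_nonneg (radialCutoff_nonneg R z)]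
  exact radialCutoff_le_one R z

/-- `χ_R = 1` on the closed ball of radius `R` (`R > 0`). [folklore] -/
theorem radialCutoff_of_norm_le {R : ℝ} (hR : 0 < R) {z : E} (h : ‖z‖ ≤ R) :
    radialCutoff R z = 1 := by
  unfold radialCutoff
  have h1 : 1 ≤ 2 - ‖z‖ / R := by
    have : ‖z‖ / R ≤ 1 := (div_le_one hR).2 h
    linarith
  rw [min_eq_left h1, max_eq_right zero_le_one]

/-- `χ_R = 0` outside the ball of radius `2R` (`R > 0`). [folklore] -/
theorem radialCutoff_of_le_norm {R : ℝ} (hR : 0 < R) {z : E} (h : 2 * R ≤ ‖z‖) :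
    radialCutoff R z = 0 := by
  unfold radialCutoff
  have h1 : 2 - ‖z‖ / R ≤ 0 := by
    have : 2 ≤ ‖z‖ / R := (le_div_iff₀ hR).2 h
    linarith
  rw [max_eq_left]
  exact (min_le_right _ _).trans h1

/-- `χ_R` is `1/R`-Lipschitz: `|χ_R(z) - χ_R(z')| ≤ ‖z - z'‖ / R` (`R > 0`). [folklore] -/
theorem abs_radialCutoff_sub_le {R : ℝ} (hR : 0 < R) (z z' : E) :
    |radialCutoff R z - radialCutoff R z'| ≤ ‖z - z'‖ / R := by
  unfold radialCutoff
  calc |max 0 (min 1 (2 - ‖z‖ / R)) - max 0 (min 1 (2 - ‖z'‖ / R))|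
      ≤ max |(0 : ℝ) - 0| |min 1 (2 - ‖z‖ / R) - min 1 (2 - ‖z'‖ / R)| :=
        abs_max_sub_max_le_max _ _ _ _
    _ = |min 1 (2 - ‖z‖ / R) - min 1 (2 - ‖z'‖ / R)| := by simp [abs_nonneg]
    _ ≤ max |(1 : ℝ) - 1| |(2 - ‖z‖ / R) - (2 - ‖z'‖ / R)| := abs_min_sub_min_le_max _ _ _ _
    _ = |(2 - ‖z‖ / R) - (2 - ‖z'‖ / R)| := by simp [abs_nonneg]
    _ = |‖z'‖ - ‖z‖| / R := by
        rw [show (2 - ‖z‖ / R) - (2 - ‖z'‖ / R) = (‖z'‖ - ‖z‖) / R by ring, abs_div,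
          abs_of_pos hR]
    _ ≤ ‖z - z'‖ / R := by
        refine div_le_div_of_nonneg_right ?_ hR.le
        rw [← norm_neg (z - z'), neg_sub]
        exact abs_norm_sub_norm_le z' z

variable [NormedSpace ℝ E]

/-- The **truncated field** `Y_R = χ_R • Y`. [folklore] -/
def truncateField (R : ℝ) (F : E → E) (z : E) : E :=
  radialCutoff R z • F z

/-- `Y_R = Y` on the closed ball of radius `R`. [folklore] -/
theorem truncateField_of_norm_le {R : ℝ} (hR : 0 < R) (F : E → E) {z : E} (h : ‖z‖ ≤ R) :
    truncateField R F z = F z := by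
  rw [truncateField, radialCutoff_of_norm_le hR h, one_smul]

/-- `Y_R = 0` outside the ball of radius `2R`. [folklore] -/
theorem truncateField_of_le_norm {R : ℝ} (hR : 0 < R) (F : E → E) {z : E} (h : 2 * R ≤ ‖z‖) :
    truncateField R F z = 0 := by
  rw [truncateField, radialCutoff_of_le_norm hR h, zero_smul]

/-- `‖Y_R‖ ≤ ‖Y‖`. [folklore] -/
theorem norm_truncateField_le (R : ℝ) (F : E → E) (z : E) : ‖truncateField R F z‖ ≤ ‖F z‖ := by
  rw [truncateField, norm_smul, Real.norm_eq_abs]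
  exact mul_le_of_le_one_left (norm_nonneg _) (abs_radialCutoff_le_one R z)

/-- The truncated field is continuous if the field is. [folklore] -/
theorem continuous_truncateField (R : ℝ) {F : E → E} (hF : Continuous F) :
    Continuous (truncateField R F) := by
  unfold truncateField radialCutoff
  fun_prop

/-- **The truncated field is globally Lipschitz**: if `Y` is `K`-Lipschitz and bounded by `M`
on the closed ball of radius `2R`, then `Y_R` is `(K + M/R)`-Lipschitz on the whole space.
[folklore] -/
theorem lipschitzWith_truncateField {R : ℝ} (hR : 0 < R) {F : E → E} {K : ℝ≥0} {M : ℝ≥0}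
    (hF : LipschitzOnWith K F (closedBall 0 (2 * R))) (hM : ∀ z ∈ closedBall (0 : E) (2 * R),
      ‖F z‖ ≤ M) :
    LipschitzWith (K + M / R.toNNReal) (truncateField R F) := by
  have hRc : ((R.toNNReal : ℝ≥0) : ℝ) = R := Real.coe_toNNReal _ hR.le
  refine LipschitzWith.of_dist_le_mul fun z z' => ?_
  rw [dist_eq_norm, dist_eq_norm, NNReal.coe_add, NNReal.coe_div, hRc]
  have hcz := abs_radialCutoff_sub_le hR z z'
  have hK0 : (0 : ℝ) ≤ K := K.coe_nonneg
  have hM0 : (0 : ℝ) ≤ M := M.coe_nonneg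
  have hzz : 0 ≤ ‖z - z'‖ := norm_nonneg _
  -- the one-sided estimate when `z'` is in the big ball and `z` is not
  have hout : ∀ {a b : E}, b ∈ closedBall (0 : E) (2 * R) → ¬ a ∈ closedBall (0 : E) (2 * R) →
      ‖truncateField R F a - truncateField R F b‖ ≤ (K + M / R) * ‖a - b‖ := by
    intro a b hb ha
    rw [mem_closedBall, dist_zero_right, not_le] at ha
    have ha0 : radialCutoff R a = 0 := radialCutoff_of_le_norm hR ha.le
    rw [truncateField, truncateField, ha0, zero_smul, zero_sub, norm_neg, norm_smul,
      Real.norm_eq_abs, abs_of_nonneg (radialCutoff_nonneg R b)]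
    have h1 : radialCutoff R b ≤ ‖a - b‖ / R := by
      have := abs_radialCutoff_sub_le hR a b
      rw [ha0, zero_sub, abs_neg, abs_of_nonneg (radialCutoff_nonneg R b)] at this
      exact this
    calc radialCutoff R b * ‖F b‖ ≤ ‖a - b‖ / R * M :=
          mul_le_mul h1 (hM b hb) (norm_nonneg _) (by positivity)
      _ = M / R * ‖a - b‖ := by ring
      _ ≤ (K + M / R) * ‖a - b‖ := by nlinarith [norm_nonneg (a - b)]
  by_cases hz : z ∈ closedBall (0 : E) (2 * R)
  · by_cases hz' : z' ∈ closedBall (0 : E) (2 * R)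
    · -- both in the big ball
      have hdec : truncateField R F z - truncateField R F z' =
          (radialCutoff R z - radialCutoff R z') • F z + radialCutoff R z' • (F z - F z') := by
        simp only [truncateField, sub_smul, smul_sub]; abel
      rw [hdec]
      calc ‖(radialCutoff R z - radialCutoff R z') • F z + radialCutoff R z' • (F z - F z')‖
          ≤ |radialCutoff R z - radialCutoff R z'| * ‖F z‖ + |radialCutoff R z'| * ‖F z - F z'‖ := by
            refine (norm_add_le _ _).trans ?_
            rw [norm_smul, norm_smul, Real.norm_eq_abs, Real.norm_eq_abs]
        _ ≤ ‖z - z'‖ / R * M + 1 * (K * ‖z - z'‖) := by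
            refine add_le_add (mul_le_mul hcz (hM z hz) (norm_nonneg _) (by positivity))
              (mul_le_mul (abs_radialCutoff_le_one R z') ?_ (norm_nonneg _) zero_le_one)
            rw [← dist_eq_norm, ← dist_eq_norm]
            exact hF.dist_le_mul z hz z' hz'
        _ = (K + M / R) * ‖z - z'‖ := by ring
    · rw [← norm_neg, neg_sub, norm_sub_rev z z']
      exact hout hz hz'
  · by_cases hz' : z' ∈ closedBall (0 : E) (2 * R)
    · exact hout hz' hz
    · rw [mem_closedBall, dist_zero_right, not_le] at hz hz'
      rw [truncateField_of_le_norm hR F hz.le, truncateField_of_le_norm hR F hz'.le, sub_zero,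
        norm_zero]
      positivity

/-- A `C¹` field on a finite-dimensional space is Lipschitz and bounded on every closed ball, so
its truncation is globally Lipschitz: existence of a Lipschitz constant. [folklore] -/
theorem exists_lipschitzWith_truncateField [FiniteDimensional ℝ E] {F : E → E}
    (hF : ContDiff ℝ 1 F) {R : ℝ} (hR : 0 < R) : ∃ K : ℝ≥0, LipschitzWith K (truncateField R F) := by
  have hd : Differentiable ℝ F := hF.differentiable one_ne_zero
  have hc : Continuous (fderiv ℝ F) := hF.continuous_fderiv one_ne_zero
  obtain ⟨C, hC⟩ := (isCompact_closedBall (0 : E) (2 * R)).exists_bound_of_continuousOn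
    hc.continuousOn
  obtain ⟨M, hM⟩ := (isCompact_closedBall (0 : E) (2 * R)).exists_bound_of_continuousOn
    hF.continuous.continuousOn
  have hlip : LipschitzOnWith ⟨max C 0, le_max_right _ _⟩ F (closedBall 0 (2 * R)) := by
    refine (convex_closedBall (0 : E) (2 * R)).lipschitzOnWith_of_nnnorm_fderiv_le
      (fun z _ => hd z) fun z hz => ?_
    rw [← NNReal.coe_le_coe, coe_nnnorm]
    exact (hC z hz).trans (le_max_left _ _)
  exact ⟨_, lipschitzWith_truncateField hR hlip (M := ⟨max M 0, le_max_right _ _⟩)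
    fun z hz => (hM z hz).trans (le_max_left _ _)⟩

/-- A `C¹` field on a finite-dimensional space is Lipschitz on every closed ball (existence of a
constant). [folklore] -/
theorem exists_lipschitzOnWith_closedBall [FiniteDimensional ℝ E] {F : E → E}
    (hF : ContDiff ℝ 1 F) (R : ℝ) : ∃ K : ℝ≥0, LipschitzOnWith K F (closedBall 0 R) := by
  have hd : Differentiable ℝ F := hF.differentiable one_ne_zero
  have hc : Continuous (fderiv ℝ F) := hF.continuous_fderiv one_ne_zero
  obtain ⟨C, hC⟩ := (isCompact_closedBall (0 : E) R).exists_bound_of_continuousOn hc.continuousOn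
  refine ⟨⟨max C 0, le_max_right _ _⟩, (convex_closedBall (0 : E) R).lipschitzOnWith_of_nnnorm_fderiv_le
    (fun z _ => hd z) fun z hz => ?_⟩
  rw [← NNReal.coe_le_coe, coe_nnnorm]
  exact (hC z hz).trans (le_max_left _ _)

end Truncate

end Literature.MathematicalPhysics.KineticTheory

namespace Literature.MathematicalPhysics.KineticTheory.HeatConduction

variable {N : ℕ}

/-! ### The energy identity along the driven dynamics -/

namespace OscillatorChain

variable (P : OscillatorChain)

/-- `DH(y)·v = ∑_i (∂_{q_i}H(y) v_{q,i} + p_i v_{p,i})`. [folklore] -/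
theorem fderiv_hamiltonian_apply (hH : Differentiable ℝ (P.hamiltonian N)) (y v : PhaseSpace N) :
    fderiv ℝ (P.hamiltonian N) y v =
      ∑ i, (partialQ i (P.hamiltonian N) y * v.1 i + y.2 i * v.2 i) := by
  rw [clm_apply_eq_sum, ← Finset.sum_add_distrib]
  refine Finset.sum_congr rfl fun i _ => ?_
  have hQ : fderiv ℝ (P.hamiltonian N) y (unitQ i) = partialQ i (P.hamiltonian N) y := by
    rw [partialQ_eq_fderiv hH, unitQ_eq]
  have hP : fderiv ℝ (P.hamiltonian N) y (unitP i) = y.2 i := by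
    rw [← P.partialP_hamiltonian N y i, partialP_eq_fderiv hH, unitP_eq]
  rw [hQ, hP, smul_eq_mul, smul_eq_mul]
  ring

/-- `∂_{q_i}H` depends on the positions only. [folklore] -/
theorem partialQ_hamiltonian_fst (y : PhaseSpace N) (e : Fin N → ℝ) (i : Fin N) :
    partialQ i (P.hamiltonian N) (y.1, y.2 + e) = partialQ i (P.hamiltonian N) y := by
  rw [partialQ_hamiltonian_eq, partialQ_hamiltonian_eq]

/-- **The energy identity with the dissipation dropped**: for the Langevin drift `Y` and a
momentum perturbation `e`,
`DH(y)·Y(y + (0, e)) = ∑_i ∂_{q_i}H e_i - γ∑_i w_i p_i² - γ∑_i w_i p_i e_i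
 ≤ ‖e‖ (∑_i |∂_{q_i}H(y)| + 2γ ∑_i |p_i|)` (`w_i = [i=0]+[i=N-1] ∈ [0,2]`, `γ ≥ 0`).
[cite: CuneoEckmannHairerReyBellet2018, §3 eq. (3.3)] -/
theorem fderiv_hamiltonian_drift_le (hH : Differentiable ℝ (P.hamiltonian N)) (hγ : 0 ≤ P.γ)
    (y : PhaseSpace N) (e : Fin N → ℝ) :
    fderiv ℝ (P.hamiltonian N) y (P.drift N (y.1, y.2 + e)) ≤
      ‖e‖ * ((∑ i, |partialQ i (P.hamiltonian N) y|) + 2 * P.γ * ∑ i, |y.2 i|) := by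
  rw [P.fderiv_hamiltonian_apply hH]
  simp only [drift, P.partialQ_hamiltonian_fst, Pi.add_apply]
  have hr : ‖e‖ * ((∑ i, |partialQ i (P.hamiltonian N) y|) + 2 * P.γ * ∑ i, |y.2 i|) =
      ∑ i, (‖e‖ * |partialQ i (P.hamiltonian N) y| + ‖e‖ * 2 * P.γ * |y.2 i|) := by
    rw [mul_add, Finset.mul_sum, Finset.mul_sum, Finset.mul_sum, ← Finset.sum_add_distrib]
    exact Finset.sum_congr rfl fun i _ => by ring
  rw [hr]
  refine Finset.sum_le_sum fun i _ => ?_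
  set a := partialQ i (P.hamiltonian N) y
  set p := y.2 i
  have he : |e i| ≤ ‖e‖ := by rw [← Real.norm_eq_abs]; exact norm_le_pi_norm e i
  have hw0 : 0 ≤ bathWeight N i := by unfold bathWeight; split_ifs <;> norm_num
  have hw2 : bathWeight N i ≤ 2 := by unfold bathWeight; split_ifs <;> norm_num
  have h1 : a * e i ≤ ‖e‖ * |a| := by
    calc a * e i ≤ |a * e i| := le_abs_self _
      _ = |a| * |e i| := abs_mul _ _
      _ ≤ |a| * ‖e‖ := mul_le_mul_of_nonneg_left he (abs_nonneg _)
      _ = ‖e‖ * |a| := mul_comm _ _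
  have h2 : -(P.γ * bathWeight N i * p * p) ≤ 0 := by
    have : 0 ≤ P.γ * bathWeight N i * (p * p) := mul_nonneg (mul_nonneg hγ hw0) (mul_self_nonneg p)
    linarith
  have h3 : -(P.γ * bathWeight N i * p * e i) ≤ ‖e‖ * 2 * P.γ * |p| := by
    calc -(P.γ * bathWeight N i * p * e i) ≤ |P.γ * bathWeight N i * p * e i| := neg_le_abs _
      _ = P.γ * bathWeight N i * (|p| * |e i|) := by
          rw [abs_mul, abs_mul, abs_mul, abs_of_nonneg hγ, abs_of_nonneg hw0]; ring
      _ ≤ P.γ * 2 * (|p| * ‖e‖) := by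
          refine mul_le_mul (mul_le_mul_of_nonneg_left hw2 hγ)
            (mul_le_mul_of_nonneg_left he (abs_nonneg _)) (by positivity) (by positivity)
      _ = ‖e‖ * 2 * P.γ * |p| := by ring
  calc a * (p + e i) + p * (-a - P.γ * bathWeight N i * (p + e i))
      = a * e i + -(P.γ * bathWeight N i * p * p) + -(P.γ * bathWeight N i * p * e i) := by ring
    _ ≤ ‖e‖ * |a| + 0 + ‖e‖ * 2 * P.γ * |p| := add_le_add (add_le_add h1 h2) h3
    _ = ‖e‖ * |a| + ‖e‖ * 2 * P.γ * |p| := by ring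

end OscillatorChain

/-! ### The linear energy bound for the pinned chain -/

section Pinned

variable {ω₂ lam β : ℝ}

/-- `U'(q) = ω₂ q + lam q³` for the pinned chain. [folklore] -/
theorem pinnedChain_deriv_U (ω₂ lam β γ q : ℝ) :
    deriv (pinnedChain ω₂ lam β γ).U q = ω₂ * q + lam * q ^ 3 := by
  show deriv (fun q => ω₂ * q ^ 2 / 2 + lam * q ^ 4 / 4) q = _
  have h : HasDerivAt (fun q => ω₂ * q ^ 2 / 2 + lam * q ^ 4 / 4)
      (ω₂ * (2 * q ^ 1 * 1) / 2 + lam * (4 * q ^ 3 * 1) / 4) q :=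
    ((((hasDerivAt_id q).pow 2).const_mul ω₂).div_const 2).add
      ((((hasDerivAt_id q).pow 4).const_mul lam).div_const 4)
  rw [h.deriv]
  ring

/-- A single pinning energy is bounded by the energy: `ω₂ q_i²/2 + lam q_i⁴/4 ≤ H`
(`lam, β ≥ 0`). [folklore] -/
theorem pinnedChain_U_le_hamiltonian (hω : 0 ≤ ω₂) (hl : 0 ≤ lam) (hβ : 0 ≤ β) (γ : ℝ) (N : ℕ)
    (x : PhaseSpace N) (i : Fin N) :
    ω₂ * x.1 i ^ 2 / 2 + lam * x.1 i ^ 4 / 4 ≤ (pinnedChain ω₂ lam β γ).hamiltonian N x := by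
  unfold OscillatorChain.hamiltonian
  have h1 : ω₂ * x.1 i ^ 2 / 2 + lam * x.1 i ^ 4 / 4 ≤
      ∑ k, (x.2 k ^ 2 / 2 + (pinnedChain ω₂ lam β γ).U (x.1 k)) := by
    calc ω₂ * x.1 i ^ 2 / 2 + lam * x.1 i ^ 4 / 4
        ≤ x.2 i ^ 2 / 2 + (pinnedChain ω₂ lam β γ).U (x.1 i) := by
          simp only [pinnedChain]; nlinarith [sq_nonneg (x.2 i)]
      _ ≤ ∑ k, (x.2 k ^ 2 / 2 + (pinnedChain ω₂ lam β γ).U (x.1 k)) :=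
          Finset.single_le_sum (f := fun k => x.2 k ^ 2 / 2 + (pinnedChain ω₂ lam β γ).U (x.1 k))
            (fun k _ => by simp only [pinnedChain]; positivity) (Finset.mem_univ i)
  have h2 : 0 ≤ ∑ k : Fin N, ∑ l : Fin N,
      (if l.val = k.val + 1 then (pinnedChain ω₂ lam β γ).V (x.1 l - x.1 k) else 0) :=
    Finset.sum_nonneg fun k _ => Finset.sum_nonneg fun l _ => by
      split_ifs
      · simp only [pinnedChain]; positivity
      · exact le_rfl
  linarith

/-- `|U'(q_i)| ≤ (ω₂/2 + 3 + lam/ω₂)(1 + H)` for the pinned chain (`ω₂ > 0`, `lam, β ≥ 0`).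
[folklore] -/
theorem pinnedChain_abs_deriv_U_le (hω : 0 < ω₂) (hl : 0 ≤ lam) (hβ : 0 ≤ β) (γ : ℝ) (N : ℕ)
    (x : PhaseSpace N) (i : Fin N) :
    |deriv (pinnedChain ω₂ lam β γ).U (x.1 i)| ≤
      (ω₂ / 2 + 3 + lam / ω₂) * (1 + (pinnedChain ω₂ lam β γ).hamiltonian N x) := by
  set H := (pinnedChain ω₂ lam β γ).hamiltonian N x
  set q := x.1 i
  have hH0 : 0 ≤ H := pinnedChain_hamiltonian_nonneg hω.le hl hβ γ N x
  have hU := pinnedChain_U_le_hamiltonian hω.le hl hβ γ N x i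
  have hq2 : ω₂ * q ^ 2 / 2 ≤ H := by nlinarith [mul_nonneg hl (by positivity : (0 : ℝ) ≤ q ^ 4)]
  have hq4 : lam * q ^ 4 / 4 ≤ H := by nlinarith [mul_nonneg hω.le (sq_nonneg q)]
  rw [pinnedChain_deriv_U]
  have h1 : |ω₂ * q + lam * q ^ 3| ≤ ω₂ * |q| + lam * |q| ^ 3 := by
    calc |ω₂ * q + lam * q ^ 3| ≤ |ω₂ * q| + |lam * q ^ 3| := abs_add_le _ _
      _ = ω₂ * |q| + lam * |q| ^ 3 := by rw [abs_mul, abs_mul, abs_of_pos hω, abs_of_nonneg hl, abs_pow]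
  have h2 : ω₂ * |q| ≤ ω₂ / 2 + H := by
    have := mul_le_mul_of_nonneg_left (abs_le_half_add_sq_half q) hω.le
    linarith
  have h3 : lam * |q| ^ 3 ≤ lam / ω₂ * H + 2 * H := by
    have h31 := mul_le_mul_of_nonneg_left (abs_pow_three_le q) hl
    have h32 : lam * (q ^ 2 / 2) ≤ lam / ω₂ * H := by
      have : q ^ 2 / 2 ≤ H / ω₂ := by rw [le_div_iff₀ hω]; linarith
      calc lam * (q ^ 2 / 2) ≤ lam * (H / ω₂) := mul_le_mul_of_nonneg_left this hl
        _ = lam / ω₂ * H := by ring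
    nlinarith
  have h4 : 0 ≤ lam / ω₂ := div_nonneg hl hω.le
  nlinarith [mul_nonneg h4 hH0]

/-- **The linear energy bound for the pinned chain**: with `H = H(x)` and
`C = N (ω₂/2 + 3 + lam/ω₂ + N² (3+β))`, `∑_i |∂_{q_i}H(x)| ≤ C (1 + H)` (`ω₂ > 0`,
`lam, β ≥ 0`). [folklore] -/
theorem pinnedChain_sum_abs_partialQ_le (hω : 0 < ω₂) (hl : 0 ≤ lam) (hβ : 0 ≤ β) (γ : ℝ)
    (N : ℕ) (x : PhaseSpace N) :
    ∑ i, |partialQ i ((pinnedChain ω₂ lam β γ).hamiltonian N) x| ≤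
      N * (ω₂ / 2 + 3 + lam / ω₂ + N ^ 2 * (3 + β)) *
        (1 + (pinnedChain ω₂ lam β γ).hamiltonian N x) := by
  set P := pinnedChain ω₂ lam β γ with hP
  set H := P.hamiltonian N x
  have hH0 : 0 ≤ H := pinnedChain_hamiltonian_nonneg hω.le hl hβ γ N x
  have hUd : Differentiable ℝ P.U := (pinnedChain_contDiff_U ω₂ lam β γ (n := 1)).differentiable one_ne_zero
  have hVd : Differentiable ℝ P.V := (pinnedChain_contDiff_V ω₂ lam β γ (n := 1)).differentiable one_ne_zero
  have hterm : ∀ i : Fin N, |partialQ i (P.hamiltonian N) x| ≤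
      (ω₂ / 2 + 3 + lam / ω₂ + N ^ 2 * (3 + β)) * (1 + H) := by
    intro i
    rw [P.partialQ_hamiltonian_eq_dPotential hUd hVd, OscillatorChain.dPotential]
    refine (abs_add_le _ _).trans ?_
    have hA := pinnedChain_abs_deriv_U_le hω hl hβ γ N x i
    have hB : |∑ k : Fin N, ∑ l : Fin N, (if l.val = k.val + 1 then
        deriv P.V (x.1 l - x.1 k) * ((if l = i then 1 else 0) - (if k = i then 1 else 0)) else 0)| ≤
        N ^ 2 * (3 + β) * (1 + H) := by
      refine (Finset.abs_sum_le_sum_abs _ _).trans ?_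
      have hkl : ∀ k l : Fin N, |(if l.val = k.val + 1 then
          deriv P.V (x.1 l - x.1 k) * ((if l = i then 1 else 0) - (if k = i then 1 else 0)) else 0)| ≤
          (3 + β) * (1 + H) := by
        intro k l
        have hs : |((if l = i then (1 : ℝ) else 0) - (if k = i then 1 else 0))| ≤ 1 := by
          split_ifs <;> norm_num
        have hnn : 0 ≤ (3 + β) * (1 + H) := mul_nonneg (by linarith) (by linarith)
        by_cases hlk : l.val = k.val + 1
        · rw [if_pos hlk, abs_mul]
          have hV' : |deriv P.V (x.1 l - x.1 k)| ≤ (3 + β) * (1 + H) := by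
            rw [hP, pinnedChain_deriv_V]
            exact abs_deriv_V_le hβ (pinnedChain_bond_le_hamiltonian hω.le hl hβ γ N x hlk)
          calc |deriv P.V (x.1 l - x.1 k)| *
                |((if l = i then (1 : ℝ) else 0) - (if k = i then 1 else 0))|
              ≤ (3 + β) * (1 + H) * 1 := mul_le_mul hV' hs (abs_nonneg _) hnn
            _ = (3 + β) * (1 + H) := mul_one _
        · rw [if_neg hlk, abs_zero]
          exact hnn
      calc ∑ k : Fin N, |∑ l : Fin N, (if l.val = k.val + 1 then
            deriv P.V (x.1 l - x.1 k) * ((if l = i then 1 else 0) - (if k = i then 1 else 0)) else 0)|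
          ≤ ∑ k : Fin N, ∑ l : Fin N, (3 + β) * (1 + H) :=
            Finset.sum_le_sum fun k _ => (Finset.abs_sum_le_sum_abs _ _).trans
              (Finset.sum_le_sum fun l _ => hkl k l)
        _ = N ^ 2 * (3 + β) * (1 + H) := by simp; ring
    nlinarith
  calc ∑ i, |partialQ i (P.hamiltonian N) x|
      ≤ ∑ _i : Fin N, (ω₂ / 2 + 3 + lam / ω₂ + N ^ 2 * (3 + β)) * (1 + H) :=
        Finset.sum_le_sum fun i _ => hterm i
    _ = N * (ω₂ / 2 + 3 + lam / ω₂ + N ^ 2 * (3 + β)) * (1 + H) := by simp; ring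

/-- `∑_i |p_i| ≤ N/2 + H` for the pinned chain (`lam, β ≥ 0`). [folklore] -/
theorem pinnedChain_sum_abs_momentum_le (hω : 0 ≤ ω₂) (hl : 0 ≤ lam) (hβ : 0 ≤ β) (γ : ℝ)
    (N : ℕ) (x : PhaseSpace N) :
    ∑ i, |x.2 i| ≤ N / 2 + (pinnedChain ω₂ lam β γ).hamiltonian N x := by
  have h := pinnedChain_harmonic_le_hamiltonian (ω₂ := ω₂) hl hβ γ N x
  have h1 : 0 ≤ ∑ i, ω₂ * x.1 i ^ 2 / 2 := Finset.sum_nonneg fun i _ => by positivity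
  calc ∑ i, |x.2 i| ≤ ∑ i : Fin N, (1 / 2 + x.2 i ^ 2 / 2) :=
        Finset.sum_le_sum fun i _ => abs_le_half_add_sq_half _
    _ = N / 2 + ∑ i, x.2 i ^ 2 / 2 := by
        rw [Finset.sum_add_distrib]
        simp only [Finset.sum_const, Finset.card_univ, Fintype.card_fin, nsmul_eq_mul]
        ring
    _ ≤ N / 2 + (pinnedChain ω₂ lam β γ).hamiltonian N x := by linarith

/-- The constant of the linear energy bound of the pinned chain. [folklore] -/
def pinnedChainEnergyConst (ω₂ lam β γ : ℝ) (N : ℕ) : ℝ :=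
  N * (ω₂ / 2 + 3 + lam / ω₂ + N ^ 2 * (3 + β)) + |γ| * (N + 2)

/-- The energy constant is nonnegative (`ω₂ > 0`, `lam, β ≥ 0`). [folklore] -/
theorem pinnedChainEnergyConst_nonneg (hω : 0 < ω₂) (hl : 0 ≤ lam) (hβ : 0 ≤ β) (γ : ℝ) (N : ℕ) :
    0 ≤ pinnedChainEnergyConst ω₂ lam β γ N := by
  unfold pinnedChainEnergyConst
  have : 0 ≤ lam / ω₂ := div_nonneg hl hω.le
  positivity

/-- **The linear energy bound**:
`∑_i |∂_{q_i}H| + 2γ ∑_i |p_i| ≤ C (1 + H)` with `C = pinnedChainEnergyConst` (`ω₂ > 0`,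
`lam, β, γ ≥ 0`). [folklore] -/
theorem pinnedChain_linearEnergyBound (hω : 0 < ω₂) (hl : 0 ≤ lam) (hβ : 0 ≤ β) {γ : ℝ}
    (hγ : 0 ≤ γ) (N : ℕ) (x : PhaseSpace N) :
    (∑ i, |partialQ i ((pinnedChain ω₂ lam β γ).hamiltonian N) x|) +
        2 * γ * ∑ i, |x.2 i| ≤
      pinnedChainEnergyConst ω₂ lam β γ N * (1 + (pinnedChain ω₂ lam β γ).hamiltonian N x) := by
  have h1 := pinnedChain_sum_abs_partialQ_le hω hl hβ γ N x
  have h2 := pinnedChain_sum_abs_momentum_le hω.le hl hβ γ N x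
  have hH0 := pinnedChain_hamiltonian_nonneg hω.le hl hβ γ N x
  unfold pinnedChainEnergyConst
  rw [abs_of_nonneg hγ]
  have h3 : 2 * γ * ∑ i, |x.2 i| ≤ γ * (N + 2) * (1 + (pinnedChain ω₂ lam β γ).hamiltonian N x) := by
    have := mul_le_mul_of_nonneg_left h2 (by positivity : 0 ≤ 2 * γ)
    nlinarith [mul_nonneg hγ hH0, mul_nonneg (mul_nonneg hγ (Nat.cast_nonneg N)) hH0]
  nlinarith

end Pinned

/-! ### Two general helpers -/

/-- Transport of a solution along equality on `[0, T]`. [folklore] -/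
theorem _root_.Literature.Analysis.ODE.IsIntegralSolutionOn.congr {E : Type*} [NormedAddCommGroup E] [NormedSpace ℝ E]
    {F : E → E} {g z z' : ℝ → E} {T : ℝ} (h : Literature.Analysis.ODE.IsIntegralSolutionOn F g z T)
    (hzz' : EqOn z z' (Icc 0 T)) : Literature.Analysis.ODE.IsIntegralSolutionOn F g z' T := by
  intro t ht
  rw [← hzz' ht, h t ht]
  congr 1
  refine intervalIntegral.integral_congr fun s hs => ?_
  rw [uIcc_of_le ht.1] at hs
  rw [hzz' ⟨hs.1, hs.2.trans ht.2⟩]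

/-- Transport of a solution along equality of the forcings on `[0, T]`. [folklore] -/
theorem _root_.Literature.Analysis.ODE.IsIntegralSolutionOn.congr_forcing {E : Type*} [NormedAddCommGroup E]
    [NormedSpace ℝ E] {F : E → E} {g g' z : ℝ → E} {T : ℝ} (h : Literature.Analysis.ODE.IsIntegralSolutionOn F g z T)
    (hgg' : EqOn g g' (Icc 0 T)) : Literature.Analysis.ODE.IsIntegralSolutionOn F g' z T := fun t ht => by
  rw [← hgg' ht]; exact h t ht

/-- A function on `ℝ` which is continuous on every `[0, T]` and clamped on `(-∞, 0]`
(`f t = f (max t 0)`) is continuous. [folklore] -/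
theorem _root_.Literature.MathematicalPhysics.KineticTheory.continuous_of_continuousOn_Icc_of_eq_max {X : Type*} [TopologicalSpace X]
    {f : ℝ → X} (h : ∀ T, ContinuousOn f (Icc 0 T)) (hf : ∀ t, f t = f (max t 0)) :
    Continuous f := by
  have hIci : ContinuousOn f (Ici 0) := by
    intro t ht
    have h1 : ContinuousWithinAt f (Icc 0 (t + 1)) t := h (t + 1) t ⟨ht, by linarith⟩
    refine h1.mono_of_mem_nhdsWithin (Filter.mem_of_superset
      (inter_mem_nhdsWithin (Ici (0 : ℝ)) (Iio_mem_nhds (by linarith : t < t + 1))) ?_)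
    rintro s ⟨hs0, hs1⟩
    exact ⟨hs0, le_of_lt hs1⟩
  have heq : f = f ∘ fun t => max t 0 := funext fun t => hf t
  rw [heq]
  exact hIci.comp_continuous (continuous_id.max continuous_const) fun t => Set.mem_Ici.2 (le_max_right _ _)

/-! ### The driven chain: truncated solutions and the a-priori energy bound -/

namespace OscillatorChain

variable (P : OscillatorChain)

/-- The forcing path of the integral equation (IE): `g(t) = x + (0, η(t))`. [folklore] -/
def forcing (x : PhaseSpace N) (η : ℝ → Fin N → ℝ) (t : ℝ) : PhaseSpace N :=
  x + ((0 : Fin N → ℝ), η t)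

/-- The Picard solution of (IE) with the drift truncated at radius `R` (`Y_R = χ_R • Y`, globally
Lipschitz), a transparent proof device: it is the honest solution as long as it stays in the ball
of radius `R`. [folklore] -/
def truncSol (N : ℕ) (R : ℝ) (x : PhaseSpace N) (η : ℝ → Fin N → ℝ) : ℝ → PhaseSpace N :=
  Literature.Analysis.ODE.forcedSolution (truncateField R (P.drift N)) (forcing x η)

/-- **The pathwise solution of the Langevin chain driven by the momentum-noise path `η`**
(CEHR (2.2) with additive noise, in integral form (IE)): the limit of the truncated Picard
solutions along the truncation radii `n + 1 → ∞` (eventually constant for the pinned chain,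
`pinnedChain_chainFlow_eqOn_truncSol`); clamped to its initial value on `(-∞, 0]`.
[cite: CuneoEckmannHairerReyBellet2018, §2 eq. (2.2) and §3 p. 7] -/
def chainFlow (N : ℕ) (x : PhaseSpace N) (η : ℝ → Fin N → ℝ) (t : ℝ) : PhaseSpace N :=
  limUnder atTop fun n : ℕ => P.truncSol N (n + 1) x η t

variable {P}

/-- The forcing is continuous for a continuous noise path. [folklore] -/
theorem continuous_forcing (x : PhaseSpace N) {η : ℝ → Fin N → ℝ} (hη : Continuous η) :
    Continuous (forcing x η) :=
  continuous_const.add (continuous_const.prodMk hη)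

/-- `g(0) = x + (0, η 0)`. [folklore] -/
theorem forcing_zero (x : PhaseSpace N) (η : ℝ → Fin N → ℝ) :
    forcing x η 0 = x + ((0 : Fin N → ℝ), η 0) := rfl

/-- Differences of forcings with the same noise are differences of initial conditions. [folklore] -/
theorem forcing_sub_forcing (x x' : PhaseSpace N) (η : ℝ → Fin N → ℝ) (t : ℝ) :
    forcing x η t - forcing x' η t = x - x' := by
  simp [forcing]

/-- The shifted forcing is the forcing of the shifted noise started at the current point:
`x' + (g(s + r) - g(s)) = forcing x' (η(s+·) - η(s)) r`. [folklore] -/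
theorem add_forcing_sub_forcing (x x' : PhaseSpace N) (η : ℝ → Fin N → ℝ) (s r : ℝ) :
    x' + (forcing x η (s + r) - forcing x η s) = forcing x' (fun r => η (s + r) - η s) r := by
  simp only [forcing]
  ext i <;> simp

end OscillatorChain

section PinnedFlow

variable {ω₂ lam β γ : ℝ}

open OscillatorChain

/-- The drift of the pinned chain is smooth. [folklore] -/
theorem pinnedChain_contDiff_drift (ω₂ lam β γ : ℝ) (N : ℕ) {n : ℕ∞} :
    ContDiff ℝ n ((pinnedChain ω₂ lam β γ).drift N) :=
  ((pinnedChain ω₂ lam β γ).contDiff_drift (pinnedChain_contDiff_U ω₂ lam β γ)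
    (pinnedChain_contDiff_V ω₂ lam β γ) N).of_le (by exact_mod_cast le_top)

/-- The Hamiltonian of the pinned chain is smooth. [folklore] -/
theorem pinnedChain_contDiff_hamiltonian (ω₂ lam β γ : ℝ) (N : ℕ) {n : WithTop ℕ∞} :
    ContDiff ℝ n ((pinnedChain ω₂ lam β γ).hamiltonian N) :=
  (pinnedChain ω₂ lam β γ).contDiff_hamiltonian (pinnedChain_contDiff_U ω₂ lam β γ)
    (pinnedChain_contDiff_V ω₂ lam β γ) N

/-- The truncated drift of the pinned chain is globally Lipschitz (some constant). [folklore] -/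
theorem pinnedChain_exists_lipschitzWith_truncDrift (ω₂ lam β γ : ℝ) (N : ℕ) {R : ℝ} (hR : 0 < R) :
    ∃ K : ℝ≥0, LipschitzWith K (truncateField R ((pinnedChain ω₂ lam β γ).drift N)) :=
  exists_lipschitzWith_truncateField (pinnedChain_contDiff_drift ω₂ lam β γ N) hR

/-- **The a-priori energy bound** (non-explosion estimate) for the truncated dynamics of the
pinned chain (`ω₂ > 0`, `lam, β, γ ≥ 0`), uniform in the truncation radius `R > 0`: if
`‖η‖ ≤ M` on `[0, T]` then the solution `z = truncSol R x η` satisfies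
`1 + H(z(t) - (0, η(t))) ≤ (1 + H(x)) e^{C M t}` on `[0, T]`, `C = pinnedChainEnergyConst`
(Grönwall for `h(t) = H(y(t))`, `y = z - (0,η)`, `y' = Y_R(z)`,
`h' = χ_R DH(y)·Y(y + (0,η)) ≤ C ‖η‖ (1 + h)`). This replaces the Itô/Lyapunov non-explosion
argument of CEHR p. 7 / Khasminskii Thm 3.5 by a pathwise one (possible because the noise is
additive). [cite: CuneoEckmannHairerReyBellet2018, §3 p. 7] -/
theorem pinnedChain_hamiltonian_truncSol_le (hω : 0 < ω₂) (hl : 0 ≤ lam) (hβ : 0 ≤ β) (hγ : 0 ≤ γ)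
    (N : ℕ) {R : ℝ} (hR : 0 < R) (x : PhaseSpace N) {η : ℝ → Fin N → ℝ} (hη : Continuous η)
    {T M : ℝ} (hM : ∀ t ∈ Icc 0 T, ‖η t‖ ≤ M) :
    ∀ t ∈ Icc 0 T, 1 + (pinnedChain ω₂ lam β γ).hamiltonian N
        ((pinnedChain ω₂ lam β γ).truncSol N R x η t - ((0 : Fin N → ℝ), η t)) ≤
      (1 + (pinnedChain ω₂ lam β γ).hamiltonian N x) *
        Real.exp (pinnedChainEnergyConst ω₂ lam β γ N * M * t) := by
  intro t ht
  set P := pinnedChain ω₂ lam β γ with hP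
  set H := P.hamiltonian N with hHdef
  set Y := P.drift N with hYdef
  set YR := truncateField R Y with hYRdef
  set g := forcing x η with hgdef
  set z := P.truncSol N R x η with hzdef
  set C := pinnedChainEnergyConst ω₂ lam β γ N with hCdef
  have hT : 0 ≤ T := ht.1.trans ht.2
  have hM0 : 0 ≤ M := (norm_nonneg _).trans (hM 0 ⟨le_rfl, hT⟩)
  have hC0 : 0 ≤ C := pinnedChainEnergyConst_nonneg hω hl hβ γ N
  obtain ⟨K, hK⟩ := pinnedChain_exists_lipschitzWith_truncDrift ω₂ lam β γ N hR
  have hYc : Continuous Y := (pinnedChain_contDiff_drift ω₂ lam β γ N (n := 0)).continuous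
  have hYRc : Continuous YR := continuous_truncateField R hYc
  have hg : Continuous g := continuous_forcing x hη
  have hz_eq : ∀ s, 0 ≤ s → z s = g s + ∫ r in (0 : ℝ)..s, YR (z r) := fun s hs =>
    Literature.Analysis.ODE.forcedSolution_eq hK hg hs
  have hzc : Continuous z := Literature.Analysis.ODE.continuous_forcedSolution hK hg
  have hHs : ContDiff ℝ 1 H := pinnedChain_contDiff_hamiltonian ω₂ lam β γ N
  have hHd : Differentiable ℝ H := hHs.differentiable one_ne_zero
  -- `y(t) = x + ∫₀ᵗ Y_R(z)`, `y' = Y_R(z)`, `y = z - (0, η)` on `[0, ∞)`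
  set y : ℝ → PhaseSpace N := fun s => x + ∫ r in (0 : ℝ)..s, YR (z r) with hydef
  have hy_deriv : ∀ s, HasDerivAt y (YR (z s)) s := fun s => by
    have h1 : HasDerivAt (fun u => ∫ r in (0 : ℝ)..u, YR (z r)) (YR (z s)) s :=
      ((hYRc.comp hzc).integral_hasStrictDerivAt 0 s).hasDerivAt
    exact h1.const_add x
  have hy_eq : ∀ s, 0 ≤ s → y s = z s - ((0 : Fin N → ℝ), η s) := fun s hs => by
    rw [hz_eq s hs]
    simp only [hydef, hgdef, forcing]
    abel
  have hz_y : ∀ s, 0 ≤ s → z s = ((y s).1, (y s).2 + η s) := fun s hs => by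
    rw [hy_eq s hs]; ext i <;> simp
  -- the energy along `y`
  set h : ℝ → ℝ := fun s => H (y s) with hhdef
  have hh_deriv : ∀ s, HasDerivAt h (fderiv ℝ H (y s) (YR (z s))) s := fun s =>
    (hHd (y s)).hasFDerivAt.comp_hasDerivAt s (hy_deriv s)
  have hh_cont : Continuous h := continuous_iff_continuousAt.2 fun s => (hh_deriv s).continuousAt
  have hbound : ∀ s ∈ Ico 0 T, fderiv ℝ H (y s) (YR (z s)) ≤ C * M * h s + C * M := by
    intro s hs
    have hB : fderiv ℝ H (y s) (Y (z s)) ≤ C * M * (1 + h s) := by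
      rw [hz_y s hs.1]
      refine (P.fderiv_hamiltonian_drift_le hHd hγ (y s) (η s)).trans ?_
      have hL := pinnedChain_linearEnergyBound hω hl hβ hγ N (y s)
      have hηs : ‖η s‖ ≤ M := hM s ⟨hs.1, hs.2.le⟩
      have hLnn : 0 ≤ (∑ i, |partialQ i (P.hamiltonian N) (y s)|) + 2 * γ * ∑ i, |(y s).2 i| := by
        have : 0 ≤ ∑ i, |(y s).2 i| := Finset.sum_nonneg fun i _ => abs_nonneg _
        have : 0 ≤ ∑ i, |partialQ i (P.hamiltonian N) (y s)| :=
          Finset.sum_nonneg fun i _ => abs_nonneg _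
        positivity
      calc ‖η s‖ * ((∑ i, |partialQ i (P.hamiltonian N) (y s)|) + 2 * P.γ * ∑ i, |(y s).2 i|)
          ≤ M * (C * (1 + H (y s))) := mul_le_mul hηs hL hLnn hM0
        _ = C * M * (1 + h s) := by ring
    have hc0 := radialCutoff_nonneg R (z s)
    have hc1 := radialCutoff_le_one R (z s)
    have hpos : 0 ≤ C * M * (1 + h s) := by
      have : 0 ≤ h s := pinnedChain_hamiltonian_nonneg hω.le hl hβ γ N (y s)
      positivity
    calc fderiv ℝ H (y s) (YR (z s)) = radialCutoff R (z s) * fderiv ℝ H (y s) (Y (z s)) := by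
          rw [hYRdef, truncateField, map_smul, smul_eq_mul]
      _ ≤ radialCutoff R (z s) * (C * M * (1 + h s)) := mul_le_mul_of_nonneg_left hB hc0
      _ ≤ 1 * (C * M * (1 + h s)) := mul_le_mul_of_nonneg_right hc1 hpos
      _ = C * M * h s + C * M := by ring
  -- Grönwall
  have hG := le_gronwallBound_of_liminf_deriv_right_le (f := h)
    (f' := fun s => fderiv ℝ H (y s) (YR (z s))) (δ := H x) (K := C * M) (ε := C * M) (a := 0)
    (b := T) hh_cont.continuousOn (fun s _ r hr => ?_) (by simp [hhdef, hydef]) hbound t ht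
  · rw [sub_zero] at hG
    have hfin : h t = H (z t - ((0 : Fin N → ℝ), η t)) := by
      show H (y t) = _
      rw [hy_eq t ht.1]
    rw [← hfin]
    rcases (mul_nonneg hC0 hM0).eq_or_lt with hK0 | hKpos
    · rw [← hK0, gronwallBound_K0] at hG
      rw [← hK0]
      simp only [zero_mul, add_zero] at hG
      simpa using hG
    · rw [gronwallBound_of_K_ne_0 hKpos.ne'] at hG
      simp only [div_self hKpos.ne', one_mul] at hG
      calc 1 + h t ≤ 1 + (H x * Real.exp (C * M * t) + (Real.exp (C * M * t) - 1)) := by linarith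
        _ = (1 + H x) * Real.exp (C * M * t) := by ring
  · have := ((hh_deriv s).hasDerivWithinAt (s := Ici s)).liminf_right_slope_le hr
    refine this.mono fun w hw => ?_
    rwa [slope_def_field, div_eq_inv_mul] at hw

/-- The radius `ρ(E) = max(√(2E/ω₂), √(2E))` of a ball containing the sublevel set `{H ≤ E}` of
the pinned chain (`pinnedChain_setOf_hamiltonian_le_subset_closedBall`). [folklore] -/
def pinnedChainSublevelRadius (ω₂ E : ℝ) : ℝ :=
  max (Real.sqrt (2 * E / ω₂)) (Real.sqrt (2 * E))

/-- `ρ` is monotone in the energy level (`ω₂ > 0`). [folklore] -/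
theorem pinnedChainSublevelRadius_mono (hω : 0 < ω₂) : Monotone (pinnedChainSublevelRadius ω₂) := by
  intro E E' h
  unfold pinnedChainSublevelRadius
  gcongr

/-- `ρ ≥ 0`. [folklore] -/
theorem pinnedChainSublevelRadius_nonneg (ω₂ E : ℝ) : 0 ≤ pinnedChainSublevelRadius ω₂ E :=
  le_max_of_le_left (Real.sqrt_nonneg _)

/-- `H(z) ≤ E` implies `‖z‖ ≤ ρ(E)`. [folklore] -/
theorem pinnedChain_norm_le_sublevelRadius (hω : 0 < ω₂) (hl : 0 ≤ lam) (hβ : 0 ≤ β) (γ : ℝ)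
    (N : ℕ) {z : PhaseSpace N} {E : ℝ} (h : (pinnedChain ω₂ lam β γ).hamiltonian N z ≤ E) :
    ‖z‖ ≤ pinnedChainSublevelRadius ω₂ E := by
  have := pinnedChain_setOf_hamiltonian_le_subset_closedBall hω hl hβ γ N E h
  rwa [mem_closedBall, dist_zero_right] at this

/-- **The a-priori radius** `R₀(E₀, M, T) = ρ((1 + E₀) e^{C M T} - 1) + M`: every truncated
solution started at energy `H(x) ≤ E₀` and driven by a noise path with `‖η‖ ≤ M` on `[0, T]`
stays in the closed ball of radius `R₀` on `[0, T]` (`pinnedChain_norm_truncSol_le`). [folklore] -/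
def pinnedChainRadius (ω₂ lam β γ : ℝ) (N : ℕ) (E₀ M T : ℝ) : ℝ :=
  pinnedChainSublevelRadius ω₂ ((1 + E₀) * Real.exp (pinnedChainEnergyConst ω₂ lam β γ N * M * T) - 1)
    + M

/-- The a-priori radius is monotone in the initial energy level (`ω₂ > 0`, `M, T ≥ 0`).
[folklore] -/
theorem pinnedChainRadius_mono (hω : 0 < ω₂) (N : ℕ) {E₀ E₀' M T : ℝ} (h : E₀ ≤ E₀') :
    pinnedChainRadius ω₂ lam β γ N E₀ M T ≤ pinnedChainRadius ω₂ lam β γ N E₀' M T := by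
  unfold pinnedChainRadius
  refine add_le_add (pinnedChainSublevelRadius_mono hω ?_) le_rfl
  have := Real.exp_pos (pinnedChainEnergyConst ω₂ lam β γ N * M * T)
  nlinarith

/-- **Truncated solutions stay in the a-priori ball**: `‖truncSol R x η (t)‖ ≤ R₀(H(x), M, T)`
on `[0, T]`, for every truncation radius `R > 0`. [folklore] -/
theorem pinnedChain_norm_truncSol_le (hω : 0 < ω₂) (hl : 0 ≤ lam) (hβ : 0 ≤ β) (hγ : 0 ≤ γ)
    (N : ℕ) {R : ℝ} (hR : 0 < R) (x : PhaseSpace N) {η : ℝ → Fin N → ℝ} (hη : Continuous η)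
    {T M : ℝ} (hM : ∀ t ∈ Icc 0 T, ‖η t‖ ≤ M) :
    ∀ t ∈ Icc 0 T, ‖(pinnedChain ω₂ lam β γ).truncSol N R x η t‖ ≤
      pinnedChainRadius ω₂ lam β γ N ((pinnedChain ω₂ lam β γ).hamiltonian N x) M T := by
  intro t ht
  set z := (pinnedChain ω₂ lam β γ).truncSol N R x η t
  have hT : 0 ≤ T := ht.1.trans ht.2
  have hM0 : 0 ≤ M := (norm_nonneg _).trans (hM 0 ⟨le_rfl, hT⟩)
  have hC0 := pinnedChainEnergyConst_nonneg hω hl hβ γ N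
  have hE := pinnedChain_hamiltonian_truncSol_le hω hl hβ hγ N hR x hη hM t ht
  have hexp : Real.exp (pinnedChainEnergyConst ω₂ lam β γ N * M * t) ≤
      Real.exp (pinnedChainEnergyConst ω₂ lam β γ N * M * T) :=
    Real.exp_le_exp.2 (mul_le_mul_of_nonneg_left ht.2 (mul_nonneg hC0 hM0))
  have hH0 := pinnedChain_hamiltonian_nonneg hω.le hl hβ γ N x
  have hy : ‖z - ((0 : Fin N → ℝ), η t)‖ ≤ pinnedChainSublevelRadius ω₂
      ((1 + (pinnedChain ω₂ lam β γ).hamiltonian N x) *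
        Real.exp (pinnedChainEnergyConst ω₂ lam β γ N * M * T) - 1) := by
    refine pinnedChain_norm_le_sublevelRadius hω hl hβ γ N ?_
    nlinarith
  have hn : ‖((0 : Fin N → ℝ), η t)‖ ≤ M := by
    rw [Prod.norm_def]; simp [hM t ht]
  calc ‖z‖ = ‖(z - ((0 : Fin N → ℝ), η t)) + ((0 : Fin N → ℝ), η t)‖ := by rw [sub_add_cancel]
    _ ≤ ‖z - ((0 : Fin N → ℝ), η t)‖ + ‖((0 : Fin N → ℝ), η t)‖ := norm_add_le _ _
    _ ≤ _ := add_le_add hy hn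

/-- **Beyond the a-priori radius the truncation is invisible**: if `R₀(H(x), M, T) ≤ R` then
`truncSol R x η` solves the UNtruncated equation (IE) on `[0, T]`. [folklore] -/
theorem pinnedChain_isIntegralSolutionOn_truncSol (hω : 0 < ω₂) (hl : 0 ≤ lam) (hβ : 0 ≤ β)
    (hγ : 0 ≤ γ) (N : ℕ) {R : ℝ} (hR : 0 < R) (x : PhaseSpace N) {η : ℝ → Fin N → ℝ}
    (hη : Continuous η) {T M : ℝ} (hM : ∀ t ∈ Icc 0 T, ‖η t‖ ≤ M)
    (hRR : pinnedChainRadius ω₂ lam β γ N ((pinnedChain ω₂ lam β γ).hamiltonian N x) M T ≤ R) :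
    Literature.Analysis.ODE.IsIntegralSolutionOn ((pinnedChain ω₂ lam β γ).drift N) (forcing x η)
      ((pinnedChain ω₂ lam β γ).truncSol N R x η) T := by
  intro t ht
  obtain ⟨K, hK⟩ := pinnedChain_exists_lipschitzWith_truncDrift ω₂ lam β γ N hR
  have h := Literature.Analysis.ODE.forcedSolution_eq hK (continuous_forcing x hη) ht.1
  unfold OscillatorChain.truncSol
  rw [h]
  congr 1
  refine intervalIntegral.integral_congr fun s hs => ?_
  rw [uIcc_of_le ht.1] at hs
  exact truncateField_of_norm_le hR _
    ((pinnedChain_norm_truncSol_le hω hl hβ hγ N hR x hη hM s ⟨hs.1, hs.2.trans ht.2⟩).trans hRR)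

/-- **Uniqueness for the untruncated equation**: two continuous solutions of (IE) (pinned chain,
same forcing) coincide on `[0, T]` — both are bounded there and the smooth drift is Lipschitz on
bounded sets. [folklore] -/
theorem pinnedChain_eqOn_of_isIntegralSolutionOn (ω₂ lam β γ : ℝ) (N : ℕ) {g z₁ z₂ : ℝ → PhaseSpace N}
    {T : ℝ} (h₁ : Literature.Analysis.ODE.IsIntegralSolutionOn ((pinnedChain ω₂ lam β γ).drift N) g z₁ T)
    (h₂ : Literature.Analysis.ODE.IsIntegralSolutionOn ((pinnedChain ω₂ lam β γ).drift N) g z₂ T) (hc₁ : Continuous z₁)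
    (hc₂ : Continuous z₂) : EqOn z₁ z₂ (Icc 0 T) := by
  obtain ⟨B₁, hB₁⟩ := isCompact_Icc.exists_bound_of_continuousOn (hc₁.continuousOn (s := Icc 0 T))
  obtain ⟨B₂, hB₂⟩ := isCompact_Icc.exists_bound_of_continuousOn (hc₂.continuousOn (s := Icc 0 T))
  obtain ⟨K, hK⟩ := exists_lipschitzOnWith_closedBall
    (pinnedChain_contDiff_drift ω₂ lam β γ N (n := 1)) (max B₁ B₂)
  refine h₁.eqOn_of_lipschitzOnWith hK h₂ hc₁ hc₂ (fun t ht => ?_) fun t ht => ?_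
  · rw [mem_closedBall, dist_zero_right]; exact (hB₁ t ht).trans (le_max_left _ _)
  · rw [mem_closedBall, dist_zero_right]; exact (hB₂ t ht).trans (le_max_right _ _)

/-- Truncated solutions with radii beyond the a-priori radius agree on `[0, T]`. [folklore] -/
theorem pinnedChain_truncSol_eqOn (hω : 0 < ω₂) (hl : 0 ≤ lam) (hβ : 0 ≤ β) (hγ : 0 ≤ γ) (N : ℕ)
    {R R' : ℝ} (hR : 0 < R) (hR' : 0 < R') (x : PhaseSpace N) {η : ℝ → Fin N → ℝ}
    (hη : Continuous η) {T M : ℝ} (hM : ∀ t ∈ Icc 0 T, ‖η t‖ ≤ M)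
    (hRR : pinnedChainRadius ω₂ lam β γ N ((pinnedChain ω₂ lam β γ).hamiltonian N x) M T ≤ R)
    (hRR' : pinnedChainRadius ω₂ lam β γ N ((pinnedChain ω₂ lam β γ).hamiltonian N x) M T ≤ R') :
    EqOn ((pinnedChain ω₂ lam β γ).truncSol N R x η) ((pinnedChain ω₂ lam β γ).truncSol N R' x η)
      (Icc 0 T) := by
  obtain ⟨K, hK⟩ := pinnedChain_exists_lipschitzWith_truncDrift ω₂ lam β γ N hR
  obtain ⟨K', hK'⟩ := pinnedChain_exists_lipschitzWith_truncDrift ω₂ lam β γ N hR'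
  exact pinnedChain_eqOn_of_isIntegralSolutionOn ω₂ lam β γ N
    (pinnedChain_isIntegralSolutionOn_truncSol hω hl hβ hγ N hR x hη hM hRR)
    (pinnedChain_isIntegralSolutionOn_truncSol hω hl hβ hγ N hR' x hη hM hRR')
    (Literature.Analysis.ODE.continuous_forcedSolution hK (continuous_forcing x hη))
    (Literature.Analysis.ODE.continuous_forcedSolution hK' (continuous_forcing x hη))

/-! ### The flow of the pinned chain -/

/-- A bound for the noise on `[0, T]` exists (continuity). [folklore] -/
theorem exists_noiseBound {η : ℝ → Fin N → ℝ} (hη : Continuous η) (T : ℝ) :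
    ∃ M, 0 ≤ M ∧ ∀ t ∈ Icc 0 T, ‖η t‖ ≤ M := by
  obtain ⟨M, hM⟩ := isCompact_Icc.exists_bound_of_continuousOn (hη.continuousOn (s := Icc 0 T))
  exact ⟨max M 0, le_max_right _ _, fun t ht => (hM t ht).trans (le_max_left _ _)⟩

/-- **The flow is the truncated solution for every radius beyond the a-priori radius**
(the defining limit is eventually constant). [folklore] -/
theorem pinnedChain_chainFlow_eqOn_truncSol (hω : 0 < ω₂) (hl : 0 ≤ lam) (hβ : 0 ≤ β) (hγ : 0 ≤ γ)
    (N : ℕ) {R : ℝ} (hR : 0 < R) (x : PhaseSpace N) {η : ℝ → Fin N → ℝ} (hη : Continuous η)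
    {T M : ℝ} (hM : ∀ t ∈ Icc 0 T, ‖η t‖ ≤ M)
    (hRR : pinnedChainRadius ω₂ lam β γ N ((pinnedChain ω₂ lam β γ).hamiltonian N x) M T ≤ R) :
    EqOn ((pinnedChain ω₂ lam β γ).chainFlow N x η) ((pinnedChain ω₂ lam β γ).truncSol N R x η)
      (Icc 0 T) := by
  intro t ht
  unfold OscillatorChain.chainFlow
  refine Filter.Tendsto.limUnder_eq (tendsto_const_nhds.congr' ?_)
  obtain ⟨n₀, hn₀⟩ := exists_nat_ge R
  filter_upwards [eventually_ge_atTop n₀] with n hn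
  have hnR : R ≤ (n : ℝ) + 1 := hn₀.trans (by exact_mod_cast Nat.le_succ_of_le hn)
  exact pinnedChain_truncSol_eqOn hω hl hβ hγ N hR (by positivity) x hη hM hRR (hRR.trans hnR) ht

/-- For `t ≤ 0` the flow is clamped at its initial value `x + (0, η 0)`. [folklore] -/
theorem pinnedChain_chainFlow_of_nonpos (ω₂ lam β γ : ℝ) (N : ℕ) (x : PhaseSpace N)
    {η : ℝ → Fin N → ℝ} (hη : Continuous η) {t : ℝ} (ht : t ≤ 0) :
    (pinnedChain ω₂ lam β γ).chainFlow N x η t = x + ((0 : Fin N → ℝ), η 0) := by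
  unfold OscillatorChain.chainFlow
  refine Filter.Tendsto.limUnder_eq (tendsto_const_nhds.congr' (Eventually.of_forall fun n => ?_))
  obtain ⟨K, hK⟩ := pinnedChain_exists_lipschitzWith_truncDrift ω₂ lam β γ N
    (by positivity : (0 : ℝ) < n + 1)
  show x + ((0 : Fin N → ℝ), η 0) = (pinnedChain ω₂ lam β γ).truncSol N (n + 1) x η t
  unfold OscillatorChain.truncSol
  rw [Literature.Analysis.ODE.forcedSolution_of_nonpos _ _ ht, Literature.Analysis.ODE.forcedSolution_zero hK (continuous_forcing x hη)]
  rfl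

/-- **The flow solves the Langevin integral equation (IE)** on every `[0, T]` (pinned chain,
`ω₂ > 0`, `lam, β, γ ≥ 0`, continuous noise path): CEHR's "strong solutions … defined for all
`t ≥ 0`", pathwise. [cite: CuneoEckmannHairerReyBellet2018, §3 p. 7] -/
theorem pinnedChain_isIntegralSolutionOn_chainFlow (hω : 0 < ω₂) (hl : 0 ≤ lam) (hβ : 0 ≤ β)
    (hγ : 0 ≤ γ) (N : ℕ) (x : PhaseSpace N) {η : ℝ → Fin N → ℝ} (hη : Continuous η) (T : ℝ) :
    Literature.Analysis.ODE.IsIntegralSolutionOn ((pinnedChain ω₂ lam β γ).drift N) (forcing x η)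
      ((pinnedChain ω₂ lam β γ).chainFlow N x η) T := by
  obtain ⟨M, -, hM⟩ := exists_noiseBound hη T
  set R := max (pinnedChainRadius ω₂ lam β γ N ((pinnedChain ω₂ lam β γ).hamiltonian N x) M T) 1
  have hR : 0 < R := lt_max_of_lt_right one_pos
  exact (pinnedChain_isIntegralSolutionOn_truncSol hω hl hβ hγ N hR x hη hM (le_max_left _ _)).congr
    (pinnedChain_chainFlow_eqOn_truncSol hω hl hβ hγ N hR x hη hM (le_max_left _ _)).symm

/-- **The flow is continuous in time** (on all of `ℝ`, being clamped on `(-∞, 0]`). [folklore] -/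
theorem pinnedChain_continuous_chainFlow (hω : 0 < ω₂) (hl : 0 ≤ lam) (hβ : 0 ≤ β) (hγ : 0 ≤ γ)
    (N : ℕ) (x : PhaseSpace N) {η : ℝ → Fin N → ℝ} (hη : Continuous η) :
    Continuous ((pinnedChain ω₂ lam β γ).chainFlow N x η) := by
  refine continuous_of_continuousOn_Icc_of_eq_max (fun T => ?_) fun t => ?_
  · obtain ⟨M, -, hM⟩ := exists_noiseBound hη T
    set R := max (pinnedChainRadius ω₂ lam β γ N ((pinnedChain ω₂ lam β γ).hamiltonian N x) M T) 1
    have hR : 0 < R := lt_max_of_lt_right one_pos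
    obtain ⟨K, hK⟩ := pinnedChain_exists_lipschitzWith_truncDrift ω₂ lam β γ N hR
    exact ((Literature.Analysis.ODE.continuous_forcedSolution hK (continuous_forcing x hη)).continuousOn).congr
      (pinnedChain_chainFlow_eqOn_truncSol hω hl hβ hγ N hR x hη hM (le_max_left _ _))
  · rcases le_total t 0 with ht | ht
    · rw [max_eq_right ht, pinnedChain_chainFlow_of_nonpos ω₂ lam β γ N x hη ht,
        pinnedChain_chainFlow_of_nonpos ω₂ lam β γ N x hη le_rfl]
    · rw [max_eq_left ht]

/-- **The flow stays in the a-priori ball**: `‖chainFlow x η t‖ ≤ R₀(H(x), M, T)` on `[0, T]`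
if `‖η‖ ≤ M` there. [folklore] -/
theorem pinnedChain_norm_chainFlow_le (hω : 0 < ω₂) (hl : 0 ≤ lam) (hβ : 0 ≤ β) (hγ : 0 ≤ γ)
    (N : ℕ) (x : PhaseSpace N) {η : ℝ → Fin N → ℝ} (hη : Continuous η) {T M : ℝ}
    (hM : ∀ t ∈ Icc 0 T, ‖η t‖ ≤ M) :
    ∀ t ∈ Icc 0 T, ‖(pinnedChain ω₂ lam β γ).chainFlow N x η t‖ ≤
      pinnedChainRadius ω₂ lam β γ N ((pinnedChain ω₂ lam β γ).hamiltonian N x) M T := by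
  intro t ht
  set R := max (pinnedChainRadius ω₂ lam β γ N ((pinnedChain ω₂ lam β γ).hamiltonian N x) M T) 1
  have hR : 0 < R := lt_max_of_lt_right one_pos
  rw [pinnedChain_chainFlow_eqOn_truncSol hω hl hβ hγ N hR x hη hM (le_max_left _ _) ht]
  exact pinnedChain_norm_truncSol_le hω hl hβ hγ N hR x hη hM t ht

/-- **Uniqueness**: any continuous solution of (IE) is the flow on `[0, T]`. [folklore] -/
theorem pinnedChain_eqOn_chainFlow (hω : 0 < ω₂) (hl : 0 ≤ lam) (hβ : 0 ≤ β) (hγ : 0 ≤ γ)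
    (N : ℕ) (x : PhaseSpace N) {η : ℝ → Fin N → ℝ} (hη : Continuous η) {z : ℝ → PhaseSpace N}
    {T : ℝ} (hz : Literature.Analysis.ODE.IsIntegralSolutionOn ((pinnedChain ω₂ lam β γ).drift N) (forcing x η) z T)
    (hzc : Continuous z) : EqOn z ((pinnedChain ω₂ lam β γ).chainFlow N x η) (Icc 0 T) :=
  pinnedChain_eqOn_of_isIntegralSolutionOn ω₂ lam β γ N hz
    (pinnedChain_isIntegralSolutionOn_chainFlow hω hl hβ hγ N x hη T) hzc
    (pinnedChain_continuous_chainFlow hω hl hβ hγ N x hη)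

/-- The flow on `[0, T]` only depends on the noise path on `[0, T]`. [folklore] -/
theorem pinnedChain_chainFlow_congr (hω : 0 < ω₂) (hl : 0 ≤ lam) (hβ : 0 ≤ β) (hγ : 0 ≤ γ)
    (N : ℕ) (x : PhaseSpace N) {η₁ η₂ : ℝ → Fin N → ℝ} (hη₁ : Continuous η₁) (hη₂ : Continuous η₂)
    {T : ℝ} (h : EqOn η₁ η₂ (Icc 0 T)) :
    EqOn ((pinnedChain ω₂ lam β γ).chainFlow N x η₁) ((pinnedChain ω₂ lam β γ).chainFlow N x η₂)
      (Icc 0 T) := by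
  refine (pinnedChain_eqOn_chainFlow hω hl hβ hγ N x hη₂ ?_
    (pinnedChain_continuous_chainFlow hω hl hβ hγ N x hη₁))
  exact (pinnedChain_isIntegralSolutionOn_chainFlow hω hl hβ hγ N x hη₁ T).congr_forcing
    fun t ht => by simp [forcing, h ht]

/-- **The cocycle (flow) property**: for `s, t ≥ 0`,
`z_{x,η}(s + t) = z_{x',η'}(t)` with `x' = z_{x,η}(s)` and the shifted noise
`η' = η(s + ·) - η(s)`. This is the pathwise identity behind the Markov property of the
transition semigroup. [folklore] -/
theorem pinnedChain_chainFlow_add (hω : 0 < ω₂) (hl : 0 ≤ lam) (hβ : 0 ≤ β) (hγ : 0 ≤ γ) (N : ℕ)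
    (x : PhaseSpace N) {η : ℝ → Fin N → ℝ} (hη : Continuous η) {s t : ℝ} (hs : 0 ≤ s) (ht : 0 ≤ t) :
    (pinnedChain ω₂ lam β γ).chainFlow N x η (s + t) =
      (pinnedChain ω₂ lam β γ).chainFlow N ((pinnedChain ω₂ lam β γ).chainFlow N x η s)
        (fun r => η (s + r) - η s) t := by
  set P := pinnedChain ω₂ lam β γ
  have hzc := pinnedChain_continuous_chainFlow hω hl hβ hγ N x hη
  have hη' : Continuous fun r => η (s + r) - η s := (hη.comp (continuous_const_add s)).sub continuous_const
  have hsol : Literature.Analysis.ODE.IsIntegralSolutionOn (P.drift N) (forcing (P.chainFlow N x η s) fun r => η (s + r) - η s)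
      (fun r => P.chainFlow N x η (s + r)) (s + t - s) := by
    have h1 := (pinnedChain_isIntegralSolutionOn_chainFlow hω hl hβ hγ N x hη (s + t)).shift
      (((pinnedChain_contDiff_drift ω₂ lam β γ N (n := 0)).continuous.comp hzc).continuousOn)
      ⟨hs, le_add_of_nonneg_right ht⟩
    exact h1.congr_forcing fun r _ => add_forcing_sub_forcing x _ η s r
  rw [add_sub_cancel_left] at hsol
  exact pinnedChain_eqOn_chainFlow hω hl hβ hγ N _ hη' hsol (hzc.comp (continuous_const_add s))
    ⟨ht, le_rfl⟩

/-- The energy is bounded on bounded sets: a bound of `H` on the closed ball `closedBall x₀ 1`.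
[folklore] -/
theorem pinnedChain_exists_bound_hamiltonian_closedBall (ω₂ lam β γ : ℝ) (N : ℕ) (x₀ : PhaseSpace N) :
    ∃ E₁, ∀ x ∈ closedBall x₀ 1, (pinnedChain ω₂ lam β γ).hamiltonian N x ≤ E₁ := by
  obtain ⟨E₁, hE₁⟩ := (isCompact_closedBall x₀ 1).exists_bound_of_continuousOn
    ((pinnedChain_continuous_hamiltonian ω₂ lam β γ N).continuousOn)
  exact ⟨E₁, fun x hx => (Real.le_norm_self _).trans (hE₁ x hx)⟩

/-- **Continuous dependence on the initial condition**: `x ↦ z_{x,η}(t)` is continuous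
(locally Lipschitz, by Grönwall for the common truncated equation). [folklore] -/
theorem pinnedChain_continuous_chainFlow_left (hω : 0 < ω₂) (hl : 0 ≤ lam) (hβ : 0 ≤ β) (hγ : 0 ≤ γ)
    (N : ℕ) {η : ℝ → Fin N → ℝ} (hη : Continuous η) (t : ℝ) :
    Continuous fun x => (pinnedChain ω₂ lam β γ).chainFlow N x η t := by
  set P := pinnedChain ω₂ lam β γ
  rcases le_or_gt t 0 with ht | ht
  · have : (fun x => P.chainFlow N x η t) = fun x => x + ((0 : Fin N → ℝ), η 0) :=
      funext fun x => pinnedChain_chainFlow_of_nonpos ω₂ lam β γ N x hη ht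
    rw [this]
    exact continuous_id.add continuous_const
  refine continuous_iff_continuousAt.2 fun x₀ => ?_
  obtain ⟨M, -, hM⟩ := exists_noiseBound hη t
  obtain ⟨E₁, hE₁⟩ := pinnedChain_exists_bound_hamiltonian_closedBall ω₂ lam β γ N x₀
  set R := max (pinnedChainRadius ω₂ lam β γ N E₁ M t) 1 with hRdef
  have hR : 0 < R := lt_max_of_lt_right one_pos
  obtain ⟨K, hK⟩ := pinnedChain_exists_lipschitzWith_truncDrift ω₂ lam β γ N hR
  -- on the ball, the flow is the truncated solution with the common radius `R`
  have heq : ∀ x ∈ closedBall x₀ 1, P.chainFlow N x η t = P.truncSol N R x η t := fun x hx =>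
    pinnedChain_chainFlow_eqOn_truncSol hω hl hβ hγ N hR x hη hM
      ((pinnedChainRadius_mono hω N (hE₁ x hx)).trans (le_max_left _ _)) ⟨ht.le, le_rfl⟩
  have hev : (fun x => P.chainFlow N x η t) =ᶠ[𝓝 x₀] fun x => P.truncSol N R x η t :=
    Filter.eventuallyEq_of_mem (closedBall_mem_nhds x₀ one_pos) heq
  refine ContinuousAt.congr_of_eventuallyEq ?_ hev
  -- the truncated solution is Lipschitz in the initial condition
  have hlip : ∀ x x' : PhaseSpace N, ‖P.truncSol N R x η t - P.truncSol N R x' η t‖ ≤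
      ‖x - x'‖ * Real.exp (K * t) := fun x x' =>
    Literature.Analysis.ODE.norm_forcedSolution_sub_le hK (continuous_forcing x hη) (continuous_forcing x' hη)
      (fun r _ => by rw [forcing_sub_forcing]) t ⟨ht.le, le_rfl⟩
  rw [Metric.continuousAt_iff]
  intro ε hε
  refine ⟨ε / Real.exp (K * t), by positivity, fun x hx => ?_⟩
  rw [dist_eq_norm] at hx ⊢
  calc ‖P.truncSol N R x η t - P.truncSol N R x₀ η t‖ ≤ ‖x - x₀‖ * Real.exp (K * t) := hlip x x₀
    _ < ε / Real.exp (K * t) * Real.exp (K * t) := by gcongr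
    _ = ε := div_mul_cancel₀ ε (Real.exp_pos _).ne'

/-! ### Measurable dependence on parameters -/

/-- **The flow depends measurably on a measurably parametrised initial condition and noise path**
(each truncated solution does, by `stronglyMeasurable_forcedSolution`, and the flow is their
pointwise — eventually constant — limit). The σ-algebra on the parameter space is an implicit
argument. [folklore] -/
theorem pinnedChain_measurable_chainFlow (hω : 0 < ω₂) (hl : 0 ≤ lam) (hβ : 0 ≤ β) (hγ : 0 ≤ γ)
    (N : ℕ) {Ω : Type*} {mΩ : MeasurableSpace Ω} {X : Ω → PhaseSpace N} (hX : Measurable X)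
    {G : Ω → ℝ → Fin N → ℝ} (hGc : ∀ w, Continuous (G w)) (hGm : ∀ t, Measurable fun w => G w t)
    (t : ℝ) : Measurable fun w => (pinnedChain ω₂ lam β γ).chainFlow N (X w) (G w) t := by
  have hn : ∀ n : ℕ, Measurable fun w =>
      (pinnedChain ω₂ lam β γ).truncSol N (n + 1) (X w) (G w) t := by
    intro n
    obtain ⟨K, hK⟩ := pinnedChain_exists_lipschitzWith_truncDrift ω₂ lam β γ N
      (by positivity : (0 : ℝ) < n + 1)
    have h := Literature.Analysis.ODE.stronglyMeasurable_forcedSolution (mΩ := mΩ) (G := fun w => forcing (X w) (G w)) hK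
      (fun w => continuous_forcing (X w) (hGc w)) (fun r => ?_) t
    · exact h.measurable
    · exact (hX.add (measurable_const.prodMk (hGm r))).stronglyMeasurable
  refine measurable_of_tendsto_metrizable hn ?_
  rw [tendsto_pi_nhds]
  intro w
  -- the sequence is eventually constant, equal to the flow
  rcases le_or_gt t 0 with ht | ht
  · have hc : ∀ n : ℕ, (pinnedChain ω₂ lam β γ).truncSol N (n + 1) (X w) (G w) t =
        X w + ((0 : Fin N → ℝ), G w 0) := by
      intro n
      obtain ⟨K, hK⟩ := pinnedChain_exists_lipschitzWith_truncDrift ω₂ lam β γ N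
        (by positivity : (0 : ℝ) < n + 1)
      unfold OscillatorChain.truncSol
      rw [Literature.Analysis.ODE.forcedSolution_of_nonpos _ _ ht, Literature.Analysis.ODE.forcedSolution_zero hK (continuous_forcing _ (hGc w))]
      rfl
    rw [pinnedChain_chainFlow_of_nonpos ω₂ lam β γ N (X w) (hGc w) ht]
    simp only [hc]
    exact tendsto_const_nhds
  · obtain ⟨M, -, hM⟩ := exists_noiseBound (hGc w) t
    set R := pinnedChainRadius ω₂ lam β γ N ((pinnedChain ω₂ lam β γ).hamiltonian N (X w)) M t
    obtain ⟨n₀, hn₀⟩ := exists_nat_ge R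
    refine tendsto_const_nhds.congr' ?_
    filter_upwards [eventually_ge_atTop n₀] with n hn
    have hnR : R ≤ (n : ℝ) + 1 := hn₀.trans (by exact_mod_cast Nat.le_succ_of_le hn)
    exact pinnedChain_chainFlow_eqOn_truncSol hω hl hβ hγ N (by positivity) (X w) (hGc w) hM hnR
      ⟨ht.le, le_rfl⟩

end PinnedFlow

end Literature.MathematicalPhysics.KineticTheory.HeatConduction
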